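import Literature.NumberTheory.Automorphic.BrandtMatrixRamified
import Literature.NumberTheory.Automorphic.BrandtModuleMaximalLocal
import HarnessLib

/-!
# At a ramified prime an order maximal at `p` is residually ramified
# (bridge from `RamifiedPrimeIdeal.lean` to `IsZOrder.IsResiduallyRamified`)

Topic `NumberTheory/Automorphic`; theorems only (no definition, no named fact, no instance).
`BrandtModuleMaximalLocal.lean` introduced the residual predicate
`IsZOrder.IsResiduallyRamified hO p`: a two-sided lattice `𝔓` with `p O ⊆ 𝔓 ⊆ O`, `𝔓 𝔓 = p O`,
`[O : 𝔓] = p²`, and `O / 𝔓` a division ring. For a prime `p` at which `ℚ_p ⊗ B` is a division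
algebra and a `ℤ`-order `O` maximal at `p` (`O_(p) = {x : nrd x, trd x ∈ ℤ_(p)}`: maximal orders
and Eichler orders, `MaximalOrderRamifiedPrime.lean`), the prime ideal
`P = normPrimeIdeal O p = {x ∈ O : p ∣ nrd x}` of `RamifiedPrimeIdeal.lean` is such a `𝔓`
(Vignéras II §1 Lemme 1.5, Cor. 1.7):

* `normPrimeIdeal_mul_self` — **`P P = p O`** as lattices (locally: `(P P)_(p) = p O_(p)`,
  `localAt_normPrimeIdeal_mul`; and `P_(q) = O_(q)` for `q ≠ p`, the index `[O : P] = p²` being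
  prime to `q`);
* `exists_inv_mod_normPrimeIdeal` — every `x ∈ O ∖ P` is invertible modulo `P`
  (`w = a x̄` with `a nrd(x) + b p = 1`);
* `IsZOrder.isResiduallyRamified_of_padic_division` — hence **`O` is residually ramified at
  `p`**; `IsMaximalZOrder.isResiduallyRamified_of_not_isSplitAt` and
  `EichlerPackage.isResiduallyRamified_of_dvd` (`p ∣ N⁻`) are the two standard instances.

## References

* M.-F. Vignéras, *Arithmétique des algèbres de quaternions*, LNM 800 (1980), Ch. II §1
  Lemme 1.5, Cor. 1.7 [VignerasLNM800].
-/

noncomputable section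

open scoped Pointwise

universe u

namespace Literature.NumberTheory.Automorphic

variable {B : Type u} [Ring B] [Algebra ℚ B] [IsQuaternionAlgebra ℚ B]
variable {O : Submodule ℤ B} {p : ℕ} [hp : Fact p.Prime]
variable (hdivp : ∀ X : ScalarExtension ℚ ℚ_[p] B, X ≠ 0 → IsUnit X)
variable (hOp : ∀ x : B, x ∈ localAt p O ↔
  ¬ p ∣ (reducedNorm ℚ B x).den ∧ ¬ p ∣ (reducedTrace ℚ B x).den)
include hdivp hOp

/-- Away from `p` the prime ideal is everything: `P_(q) = O_(q)` for primes `q ≠ p`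
(`[O : P] = p²` is prime to `q`). [folklore] -/
theorem localAt_normPrimeIdeal_of_ne (hO : IsZOrder O) {q : ℕ} (hq : q.Prime) (hqp : q ≠ p) :
    localAt q (normPrimeIdeal O p) = localAt q O := by
  refine (localAt_eq_of_smul_le (normPrimeIdeal_le O p) (pow_ne_zero 2 hp.out.ne_zero)
    (Nat.Coprime.pow_left 2 ((Nat.coprime_primes hp.out hq).mpr (Ne.symm hqp))) fun x hx => ?_).symm
  rw [← relIndex_normPrimeIdeal hdivp hOp hO]
  exact relIndex_smul_mem hx

/-- **`P P = p O`** for the prime ideal above a ramified prime of an order maximal at `p`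
(Vignéras II §1 Cor. 1.7: `P² = O p`), as an equality of lattices: checked prime by prime. [cite: VignerasLNM800, Ch. II §1 Cor. 1.7] -/
theorem normPrimeIdeal_mul_self (hO : IsZOrder O) :
    normPrimeIdeal O p * normPrimeIdeal O p = (p : ℤ) • O := by
  refine le_antisymm (normPrimeIdeal_mul_le hdivp hOp hO)
    (le_iff_forall_prime_localAt_le.mpr fun q hq => ?_)
  haveI : Fact q.Prime := ⟨hq⟩
  by_cases hqp : q = p
  · subst hqp
    rw [localAt_normPrimeIdeal_mul hdivp hOp hO]
  · rw [← localAt_mul_localAt_eq, localAt_normPrimeIdeal_of_ne hdivp hOp hO hq hqp,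
      hO.localAt_mul_localAt]
    exact localAt_mono q (Submodule.smul_le_self_of_tower _ O)

omit hdivp hOp in
/-- **`O / P` is a division ring**: every `x ∈ O ∖ P` has an inverse modulo `P`, namely
`w = a x̄` where `a nrd(x) + b p = 1` (`x ∉ P` means `p ∤ nrd x`). [cite: VignerasLNM800, Ch. II §1 Lemme 1.5] -/
theorem exists_inv_mod_normPrimeIdeal (hO : IsZOrder O) {x : B} (hx : x ∈ O)
    (hxP : x ∉ normPrimeIdeal O p) :
    ∃ w ∈ O, x * w - 1 ∈ normPrimeIdeal O p ∧ w * x - 1 ∈ normPrimeIdeal O p := by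
  obtain ⟨N, hN⟩ := hO.exists_int_reducedNorm hx
  -- `p ∤ N`
  have hpN : ¬ (p : ℤ) ∣ N := fun ⟨k, hk⟩ =>
    hxP (mem_normPrimeIdeal_of_mem hx ⟨k, by rw [hN, hk]; push_cast; ring⟩)
  have hcop : IsCoprime N (p : ℤ) := by
    rw [Int.isCoprime_iff_gcd_eq_one]
    rcases (Nat.dvd_prime hp.out).mp (by exact_mod_cast Int.gcd_dvd_right N p : Int.gcd N p ∣ p)
      with h1 | h2
    · exact h1
    · exfalso; apply hpN
      have := Int.gcd_dvd_left N p
      rw [h2] at this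
      exact this
  obtain ⟨a, b, hab⟩ := hcop
  refine ⟨a • standardInvolution ℚ B x, O.smul_mem a (hO.toIsOrder.standardInvolution_mem hx), ?_, ?_⟩
  · -- `x (a x̄) - 1 = a nrd x - 1 = -b p`
    have h : x * (a • standardInvolution ℚ B x) - 1 = (-b * p : ℤ) • (1 : B) := by
      rw [mul_smul_comm, mul_standardInvolution_holds ℚ B, hN, Algebra.algebraMap_eq_smul_one,
        Int.cast_smul_eq_zsmul, smul_smul]
      have : a * N = 1 - b * p := by linear_combination hab
      rw [this, sub_smul, one_smul, sub_sub_cancel_left, neg_mul, neg_smul]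
    rw [h, mul_comm, mul_smul]
    exact smul_le_normPrimeIdeal hO (Submodule.smul_mem_pointwise_smul _ _ O (O.smul_mem _ hO.one_mem))
  · have h : (a • standardInvolution ℚ B x) * x - 1 = (-b * p : ℤ) • (1 : B) := by
      rw [smul_mul_assoc, IsQuaternionAlgebra.standardInvolution_mul, hN,
        Algebra.algebraMap_eq_smul_one, Int.cast_smul_eq_zsmul, smul_smul]
      have : a * N = 1 - b * p := by linear_combination hab
      rw [this, sub_smul, one_smul, sub_sub_cancel_left, neg_mul, neg_smul]
    rw [h, mul_comm, mul_smul]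
    exact smul_le_normPrimeIdeal hO (Submodule.smul_mem_pointwise_smul _ _ O (O.smul_mem _ hO.one_mem))

/-- **At a ramified prime, an order maximal at `p` is residually ramified** (in the sense of
`BrandtModuleMaximalLocal.lean`), with `𝔓 = normPrimeIdeal O p`. [cite: VignerasLNM800, Ch. II §1 Lemme 1.5 and Cor. 1.7] -/
theorem IsZOrder.isResiduallyRamified_of_padic_division (hO : IsZOrder O) :
    hO.IsResiduallyRamified p :=
  ⟨normPrimeIdeal O p, smul_le_normPrimeIdeal hO, normPrimeIdeal_le O p,
    Submodule.mul_le.mpr fun _ ha _ hx => mul_mem_normPrimeIdeal_left hO ha hx,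
    Submodule.mul_le.mpr fun _ hx _ ha => mul_mem_normPrimeIdeal_right hO ha hx,
    normPrimeIdeal_mul_self hdivp hOp hO, relIndex_normPrimeIdeal hdivp hOp hO,
    fun _ hx hxP => exists_inv_mod_normPrimeIdeal hO hx hxP⟩

omit hdivp hOp

/-- **A maximal order is residually ramified at every ramified prime** `p = p_v`,
`¬ IsSplitAt B v`. [cite: VignerasLNM800, Ch. II §1 Lemme 1.5 and Cor. 1.7] -/
theorem IsMaximalZOrder.isResiduallyRamified_of_not_isSplitAt {O : Submodule ℤ B}
    (hO : IsMaximalZOrder O) (v : IsDedekindDomain.HeightOneSpectrum (NumberField.RingOfIntegers ℚ))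
    (hv : ¬ IsSplitAt B v) (hpv : ((Rat.HeightOneSpectrum.primesEquiv v : Nat.Primes) : ℕ) = p) :
    hO.1.IsResiduallyRamified p :=
  have hdivp := forall_isUnit_scalarExtension_padic_of_not_isSplitAt B v hv p hpv
  hO.1.isResiduallyRamified_of_padic_division hdivp (hO.maximalAtP hdivp)

/-- **The Eichler order of an Eichler package is residually ramified at every `p ∣ N⁻`.** [cite: VignerasLNM800, Ch. II §1 Lemme 1.5 and Cor. 1.7] -/
theorem EichlerPackage.isResiduallyRamified_of_dvd {Nplus Nminus : ℕ} (P : EichlerPackage Nplus Nminus)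
    (hpN : p ∣ Nminus) : P.isEichlerOrder.isZOrder.IsResiduallyRamified p :=
  P.isEichlerOrder.isZOrder.isResiduallyRamified_of_padic_division
    (P.forall_isUnit_scalarExtension_padic hpN) (P.maximalAtP hpN)

end Literature.NumberTheory.Automorphic

end
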